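import Summits.CriticalPhenomena.PercolationContinuityZ3.Theorems.Transplant.AutRelMilnorKernel
import HarnessLib

/-!
# The relative Milnor lemma for actions by automorphisms, III: rank TWO (apply rank one twice, the second time on the Rips graph at the first
# scale), and the growth dichotomy at the base vertex

builds on p205010 (kernel theorem, internal audit signed; external expert review pending) — nothing in this file uses p205010 and nothing here is about percolation.  Lane `prim-bschramm`, seat `prim-bschramm-p4` gen 25
(PART C3 of `P4-GENERAL.md` §47: INPUT(G) WITHOUT FINITE STABILISERS).  Helper file (`--supports stmt-CriticalPhenomena-4575 --as helper`).

* §9 the Rips graph `rips G m` (`u ~ v` iff `0 < d_G(u,v) ≤ m`): locally finite, contains `G` (`m ≥ 1`), balls `B_Rips(u,n) ⊆ B_G(u, nm)`, so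
  subexponential growth at `t` passes to it, and an action by automorphisms of `G` acts by automorphisms of it;
* §10 **`AutMilnor.ker_eq_closure_bounded`**: `B = ⟨T ∪ Stab(t)⟩` (`T` finite) acting by automorphisms on connected locally finite `G` with
  subexponential balls about `t`, `c : B → ℤ²` killing `Stab(t)` ⟹ `ker c = ⟨g ∈ ker c : g • t ∈ B(t, m)⟩` for some `m`: rank one (file II) for
  the first coordinate gives `K₁ = ⟨T₁ ∪ Stab(t)⟩` with `T₁` FINITE (kernel representatives of the finitely many vertices of `B(t, m₁)`), and
  rank one for the second coordinate on the Rips graph at scale `m₁`, where `T₁` has displacement `≤ 1`;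
* §11 off exponential growth, a transitive action has `∀ R ≥ 1 ∃ m, |B(t, mR)| < 2^m` (ball volumes do not depend on the centre; the tree's
  `Milnor.hasExponentialGrowth_of_two_pow_le`).
[cite: MilnorSolvableGrowth1968, Lemma 1 pp. 447–448] [cite: Rosset1976, Thm. 1] [cite: Hutchcroft2016, §1 (exponential growth)]
-/

noncomputable section

namespace Summit.CriticalPhenomena.PercolationContinuityZ3.Theorems.Transplant

open SimpleGraph Filter Literature.Barriers.CriticalPhenomena Literature.Probability.LatticeModels Literature.Probability.Percolation
open scoped Classical

namespace AutMilnor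

variable {V : Type} {G : SimpleGraph V} {B : Type} [Group B] [MulAction B V]

/-! ## §9 The Rips graph at scale `m` (same vertices, `u ~ v` iff `0 < d_G(u,v) ≤ m`) -/

/-- **The Rips graph** of `G` at scale `m`: `u ~ v` iff `u ≠ v` and `v ∈ B_G(u, m)`. [folklore] -/
def rips (G : SimpleGraph V) (m : ℕ) : SimpleGraph V where
  Adj u v := u ≠ v ∧ v ∈ graphBall G u m
  symm := ⟨fun _ _ h => ⟨h.1.symm, (mem_graphBall_comm G).1 h.2⟩⟩
  loopless := ⟨fun _ h => h.1 rfl⟩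

omit [Group B] [MulAction B V] in
/-- Adjacency in the Rips graph. [folklore] -/
theorem rips_adj {m : ℕ} {u v : V} : (rips G m).Adj u v ↔ (u ≠ v ∧ v ∈ graphBall G u m) := Iff.rfl

/-- The Rips graph of a locally finite graph is locally finite (neighbourhoods lie in balls). [folklore] -/
instance rips_locallyFinite [G.LocallyFinite] (m : ℕ) : (rips G m).LocallyFinite := fun u =>
  ((graphBall_finite G u m).subset (fun _ hv => (rips_adj.1 hv).2)).fintype

omit [Group B] [MulAction B V] in
/-- `G` is a subgraph of its Rips graph at every scale `m ≥ 1`. [folklore] -/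
theorem le_rips {m : ℕ} (hm : 1 ≤ m) : G ≤ rips G m := fun u v h =>
  rips_adj.2 ⟨h.ne, graphBall_mono _ _ hm ⟨h.toWalk, by rw [Walk.length_cons, Walk.length_nil]⟩⟩

omit [Group B] [MulAction B V] in
/-- The Rips graph of a connected graph is connected (`m ≥ 1`). [folklore] -/
theorem rips_connected {m : ℕ} (hm : 1 ≤ m) (hc : G.Connected) : (rips G m).Connected := hc.mono (le_rips hm)

omit [Group B] [MulAction B V] in
/-- A Rips walk of length `ℓ` ends in the `G`-ball of radius `ℓ m`. [folklore] -/
theorem mem_graphBall_of_ripsWalk {m : ℕ} : ∀ {u v : V} (w : (rips G m).Walk u v), v ∈ graphBall G u (w.length * m)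
  | _, _, Walk.nil => by rw [Walk.length_nil, Nat.zero_mul]; exact mem_graphBall_self G _ 0
  | _, _, Walk.cons h w => by
    rw [Walk.length_cons, show (w.length + 1) * m = m + w.length * m by ring]
    exact mem_graphBall_add G (rips_adj.1 h).2 (mem_graphBall_of_ripsWalk w)

omit [Group B] [MulAction B V] in
/-- **Rips balls lie in `G`-balls**: `B_{Rips}(u, n) ⊆ B_G(u, n m)`. [folklore] -/
theorem graphBall_rips_subset (m : ℕ) (u : V) (n : ℕ) : graphBall (rips G m) u n ⊆ graphBall G u (n * m) := by
  rintro v ⟨w, hw⟩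
  exact graphBall_mono _ _ (Nat.mul_le_mul_right m hw) (mem_graphBall_of_ripsWalk w)

omit [Group B] [MulAction B V] in
/-- A `G`-ball of radius `m` lies in the Rips ball of radius `1`. [folklore] -/
theorem mem_graphBall_rips_one {m : ℕ} {u v : V} (hv : v ∈ graphBall G u m) : v ∈ graphBall (rips G m) u 1 := by
  by_cases h : u = v
  · subst h; exact mem_graphBall_self _ _ _
  · exact ⟨(rips_adj.2 ⟨h, hv⟩ : (rips G m).Adj u v).toWalk, by rw [Walk.length_cons, Walk.length_nil]⟩

omit [Group B] [MulAction B V] in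
/-- **Rips ball volumes are dominated**: `|B_{Rips}(u, n)| ≤ |B_G(u, n m)|`. [folklore] -/
theorem ballVolume_rips_le [G.LocallyFinite] (m : ℕ) (u : V) (n : ℕ) : ballVolume (rips G m) u n ≤ ballVolume G u (n * m) :=
  Set.ncard_le_ncard (graphBall_rips_subset m u n) (graphBall_finite G u _)

omit [Group B] [MulAction B V] in
/-- Subexponential growth at `t` along linear scales passes to the Rips graph. [folklore] -/
theorem subexp_rips [G.LocallyFinite] {t : V} (hsub : ∀ R : ℕ, 1 ≤ R → ∃ n : ℕ, ballVolume G t (n * R) < 2 ^ n) {m : ℕ} (hm : 1 ≤ m) :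
    ∀ R : ℕ, 1 ≤ R → ∃ n : ℕ, ballVolume (rips G m) t (n * R) < 2 ^ n := by
  intro R hR
  obtain ⟨n, hn⟩ := hsub (R * m) (Nat.one_le_iff_ne_zero.2 (Nat.mul_ne_zero (by omega) (by omega)))
  exact ⟨n, lt_of_le_of_lt (by rw [← Nat.mul_assoc]; exact ballVolume_rips_le m t (n * R)) hn⟩

/-- An action by automorphisms of `G` acts by automorphisms of its Rips graphs (it is isometric on balls). [folklore] -/
theorem rips_isActionByAut (hact : IsActionByAut G B) (m : ℕ) : IsActionByAut (rips G m) B := by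
  intro g x y
  rw [rips_adj, rips_adj, smul_mem_graphBall_iff hact g, (MulAction.injective g).ne_iff]

/-! ## §10 THE RELATIVE KERNEL LEMMA for `ℤ²`: apply rank one twice, the second time on the Rips graph at the first scale -/

/-- **THE RELATIVE MILNOR KERNEL LEMMA (rank two).**  `B` acts by automorphisms on a connected locally finite graph whose balls about `t` grow
subexponentially along every linear scale, `B = ⟨T ∪ Stab(t)⟩` with `T` finite, and `c : B → ℤ²` kills `Stab(t)`.  Then `ker c` is generated by its
elements moving `t` by at most `m`, for some `m`.  (First coordinate: rank one on `G`; the kernel `K₁` is then `⟨T₁ ∪ Stab(t)⟩` with `T₁` finite —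
kernel representatives of the ball of radius `m₁` — and rank one applies to the second coordinate on the Rips graph at scale `m₁`.)
[cite: MilnorSolvableGrowth1968, Lemma 1 pp. 447–448] [cite: Rosset1976, Thm. 1] [cite: BenjaminiSchramm1996, §2 (almost transitive graphs)] -/
theorem ker_eq_closure_bounded [G.LocallyFinite] (hact : IsActionByAut G B) (hc : G.Connected) (t : V)
    (hsub : ∀ R : ℕ, 1 ≤ R → ∃ m : ℕ, ballVolume G t (m * R) < 2 ^ m) (T : Finset B)
    (hT : Subgroup.closure (↑T ∪ (↑(MulAction.stabilizer B t) : Set B)) = ⊤) (c : B →* Multiplicative (Site 2))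
    (hc1 : ∀ h ∈ MulAction.stabilizer B t, c h = 1) :
    ∃ m : ℕ, c.ker = Subgroup.closure {g | g ∈ c.ker ∧ g • t ∈ graphBall G t m} := by
  set H := MulAction.stabilizer B t with hH_def
  -- first coordinate
  set ψ₀ : B →* Multiplicative ℤ := (Milnor.coordHom 0).comp c with hψ₀_def
  have hψ₀ : ∀ h ∈ H, ψ₀ h = 1 := fun h hh => by rw [hψ₀_def, MonoidHom.comp_apply, hc1 h hh, map_one]
  obtain ⟨m₁, hm₁⟩ := inf_ker_eq_closure_bounded hact hc t hsub T ψ₀ hψ₀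
  rw [hT, top_inf_eq] at hm₁
  set m₁' := max m₁ 1 with hm₁'_def
  have hm₁'1 : 1 ≤ m₁' := le_max_right _ _
  -- kernel representatives (default `1`) of the vertices of the ball of radius `m₁'`
  have hrep : ∀ v : V, ∃ g : B, g ∈ ψ₀.ker ∧ ((∃ g' ∈ ψ₀.ker, g' • t = v) → g • t = v) := by
    intro v
    by_cases h : ∃ g' ∈ ψ₀.ker, g' • t = v
    · obtain ⟨g', hg', hv⟩ := h; exact ⟨g', hg', fun _ => hv⟩
    · exact ⟨1, one_mem _, fun h' => absurd h' h⟩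
  choose rep hrepK hrep using hrep
  set T₁ : Finset B := (graphBall_finite G t m₁').toFinset.image rep with hT₁_def
  have hK₁ : Subgroup.closure (↑T₁ ∪ (↑H : Set B)) = ψ₀.ker := by
    refine le_antisymm ((Subgroup.closure_le _).2 ?_) ?_
    · rintro g (hg | hg)
      · obtain ⟨v, -, rfl⟩ := Finset.mem_image.1 (Finset.mem_coe.1 hg)
        exact hrepK v
      · exact hψ₀ g hg
    · rw [hm₁]
      refine (Subgroup.closure_le _).2 ?_
      rintro g ⟨hgK, hgm⟩
      have hgm' : g • t ∈ graphBall G t m₁' := graphBall_mono _ _ (le_max_left _ _) hgm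
      have hr := hrep (g • t) ⟨g, hgK, rfl⟩
      have hmemT : rep (g • t) ∈ T₁ := Finset.mem_image.2 ⟨g • t, (Set.Finite.mem_toFinset _).2 hgm', rfl⟩
      have hstab : (rep (g • t))⁻¹ * g ∈ H := by
        rw [hH_def, MulAction.mem_stabilizer_iff, mul_smul, inv_smul_eq_iff]
        exact hr.symm
      have e : g = rep (g • t) * ((rep (g • t))⁻¹ * g) := by group
      rw [e]
      exact mul_mem (Subgroup.subset_closure (Set.mem_union_left _ (Finset.mem_coe.2 hmemT)))
        (Subgroup.subset_closure (Set.mem_union_right _ hstab))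
  -- second coordinate, on the Rips graph at scale `m₁'`
  set ψ₁ : B →* Multiplicative ℤ := (Milnor.coordHom 1).comp c with hψ₁_def
  have hψ₁ : ∀ h ∈ H, ψ₁ h = 1 := fun h hh => by rw [hψ₁_def, MonoidHom.comp_apply, hc1 h hh, map_one]
  obtain ⟨m₂, hm₂⟩ := inf_ker_eq_closure_bounded (G := rips G m₁') (rips_isActionByAut hact m₁') (rips_connected hm₁'1 hc) t
    (subexp_rips hsub hm₁'1) T₁ ψ₁ hψ₁
  rw [hK₁] at hm₂
  have hker : c.ker = ψ₀.ker ⊓ ψ₁.ker := Milnor.ker_eq_inf c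
  refine ⟨m₂ * m₁', le_antisymm ?_ ((Subgroup.closure_le _).2 fun g hg => hg.1)⟩
  intro g hg
  rw [hker] at hg ⊢
  have hmono : {g | g ∈ ψ₀.ker ⊓ ψ₁.ker ∧ g • t ∈ graphBall (rips G m₁') t m₂} ⊆
      {g | g ∈ ψ₀.ker ⊓ ψ₁.ker ∧ g • t ∈ graphBall G t (m₂ * m₁')} :=
    fun g' hg' => ⟨hg'.1, graphBall_rips_subset m₁' t m₂ hg'.2⟩
  exact Subgroup.closure_mono hmono (hm₂.le hg)

/-! ## §11 Growth: off exponential growth, balls about `t` are subexponential along every linear scale (transitive actions) -/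

/-- **No exponential growth ⟹ `∀ R ≥ 1 ∃ m, |B(t, mR)| < 2^m`** for a transitive action by automorphisms (ball volumes do not depend on the
centre). [cite: Hutchcroft2016, §1 (exponential growth)] [cite: MilnorSolvableGrowth1968, p. 447] -/
theorem subexp_of_not_hasExponentialGrowth [G.LocallyFinite] (hact : IsActionByAut G B) {t : V} (htr : ∀ v : V, ∃ a : B, a • t = v)
    (hG : ¬ HasExponentialGrowth G) : ∀ R : ℕ, 1 ≤ R → ∃ m : ℕ, ballVolume G t (m * R) < 2 ^ m := by
  intro R hR
  by_contra hno
  push Not at hno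
  exact hG (Milnor.hasExponentialGrowth_of_two_pow_le G hR fun x m => by
    obtain ⟨a, rfl⟩ := htr x
    rw [← smulIso_apply hact a t, ballVolume_map_eq]
    exact hno m)

end AutMilnor

end Summit.CriticalPhenomena.PercolationContinuityZ3.Theorems.Transplant

end
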